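import Literature.MathematicalPhysics.QuantumFieldTheory.BalabanImbrieJaffe1984to88.BIJ88RT51GeneralStep

/-!
# `BalabanImbrieJaffe1984to88.BIJ88RT51Density` — T. Bałaban, J. Imbrie, A. Jaffe, *Effective action and cluster properties of the
abelian Higgs model*, Commun. Math. Phys. **114** (1988) 257–315 [BalabanImbrieJaffe1988], Sect. 5.1 *Renormalization Transformation*,
p. 277 [PDF 21]: the MEASURE-LEVEL ENGINE behind the density `ρ̃^L_{k+1}(v, ψ)` of **(5.1.1)** — file 1/2 of seat p34 gen 6 (file 2/2
`BIJ88RT51Exists` assembles the density and PROVES that it satisfies the typed (5.1.1) `BIJ88RT51GeneralStep.IsRT511` / `IsRT511Ax`).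

statement-level skeleton of published theorems with citation tags; proofs where landed; nothing here is a claim about the Yang–Mills mass gap

PDF held: `paper:balaban1988-cmp114-bij-abelian-higgs-effective-action` (journal page = PDF page + 256); p. 277 [PDF 21] read as an image
(r16's CCITT-G4 render `HOME/lit-balaban-r16/renders/cmp114/original-p021-x2.png`, re-read by this seat).

CITATION HEADER (lean-in-tree rule).  Part of the lit-balaban TYPED SKELETON (HOME `run/shared/lean/pub/lit-balaban/`), PHASE-2 proof seat
p34 gen 6 (unit `lit-balaban-p34-g6`; TAKING line HOME/STATUS.md 2026-08-21T07:13Z, free-target protocol G.5-34(d), own lineage = the C1/C2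
renormalization-transformation line of seat p34).  Row served: **`C2.Eq5.1.1-5.1.4`** of `HOME/lit-balaban-r16/ROWS-C2-part2.md` (fold owner r16),
the EXISTENCE half: p. 277 *"A density of ρ̃^L_{k+1}(v, ψ) is obtained by applying the renormalization transformations of [1] to ρ′_k as
follows: ρ̃^L_{k+1}(v, ψ) = … ≡ Σ_{{X_ω}} ∫𝒟u δ(v/Qu) ∫ Π_{j=0}^{k−1} 𝒟u^{(j)}_{Λ^{(j)c*}_{10}} ∫𝒟φ × exp[−½aL⁻²⟨ψ − Q(u_k)φ, ψ − Q(u_k)φ⟩ − E^{(k)}]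
ρ′_k(u, φ, {X_ω}, {u^{(j)}}). (5.1.1)"*.

CARRIERS (all of record; nothing re-declared).  Levels `k` (`u : GaugeField P k U1`, `φ : HiggsField P k`) and `k + 1` (`v`, `ψ`) of
`Balaban1983to89.Setup`; the earlier fields `{u^{(j)}}_{j<k}` = `BIJ88InductiveForm41.Prev P k` with `prevMeasure` (product of normalized Haar
measures); `𝒟u` = `fieldMeasure P k U1`, `∫𝒟u δ_{Ax}(u)(·)` = r18's `BIJ88RenormTransf311.axialMeasure`, `𝒟φ`, `dψ` = Lebesgue measure,
`dv` = `fieldMeasure P (k+1) U1`; the normalized `ψ`-Gaussian `exp[−½aL⁻²⟨ψ − c, ψ − c⟩ − |T_L^{(k+1)}|E^{(k)}]` = r18's `gaussWeight a c ψ`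
((5.1.2) per site ↔ (3.12) total, gen 5's `BIJ88RT51GeneralStep.E0step_level_eq_normE`; unit `dψ`-mass `integral_gaussWeight`, as an
approximate `δ`-function `BIJ88RT311Exists.gaussApprox`).

WHAT IS CONSTRUCTED / PROVED HERE (the measure-level reading of the `δ`-functions of [2] = [BalabanImbrieJaffe1985] (3.3)–(3.6), as in gen
2's `BIJ85RT33.RTData.rt`, generalized from the `φ`-smeared density of ONE history-free term in the axial gauge to an ARBITRARY complex weight
over an ARBITRARY `u`-measure `ν` — needed because (5.1.1) smears over `({u^{(j)}}, φ)` and comes with and without `δ_{Ax}`).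
* §1 ENGINE.  For a `u`-measure `ν` (`𝒟u` or `𝒟u δ_{Ax}(u)`), a block average `Qu` and a complex weight `G(u, ψ)`: `rnC ν Qu G (v, ψ)` := the
  Radon–Nikodym density at `(v, ψ)` w.r.t. `dv dψ` of the push-forward along the constraint map `(u, ψ) ↦ (Qu, ψ)` (`conMap`) of
  `G · (ν ⊗ dψ)` (real/imaginary and positive/negative parts: four `Measure.rnDeriv`s — `pushLaw`, `rnRe`).  PROVED: it is jointly measurable
  (`measurable_rnC`), `dv dψ`-integrable for `ν ⊗ dψ`-integrable `G` (`integrable_rnC`), and — under the Haar regularity `ν.map Qu ≪ dv` —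
  **it integrates test functions back to the fine lattice**: `∫dv dψ (rnC G)(v, ψ) g(v, ψ) = ∫ν(du)∫dψ G(u, ψ) g(Qu, ψ)` for every bounded
  measurable `g` (**`integral_rnC_mul`**, `Measure.integral_rnDeriv_smul`; absolute continuity `pushLaw_absolutelyContinuous`).
* §2 THE SMEARED TERM DENSITY `G_t(u, ψ) = ∫Π𝒟u^{(j)} ∫𝒟φ ρ′_t({u^{(j)}}, u, φ) gaussWeight_a(Q_t({u^{(j)}}, u, φ), ψ)` (`smear51`; `Q_t = Q(u_k)φ`
  the background kernel of the term, as data) is jointly measurable (`measurable_smear51`), `ν ⊗ dψ`-INTEGRABLE whenever `ρ′_t` is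
  `ν ⊗ Π𝒟u^{(j)} ⊗ 𝒟φ`-integrable (`integrable_smear51`, from `lintegral_norm_smear51_le`: Tonelli and the unit `dψ`-mass of the Gaussian,
  `a > 0`, `d ≥ 2`), and at fixed `u` Fubini puts a bounded test function under the `({u^{(j)}}, φ)`-integrals (`integral_smear51_mul`).
NOT DONE HERE (honest scope).  The assembly `ρ̃^L_{k+1} = Σ_t rnC ν Qu G_t` and the proof of (5.1.1) for it are file 2/2; the background kernels,
`u_k`, `{X_ω}`, `ρ′_k` are DATA as in gen 5's files; no bound.  Definitions with bodies (`conMap`, `pushLaw`, `rnRe`, `rnC`, `smear51`) and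
theorems; re-declares nothing; imports Literature + Mathlib only; NO `Prop`-valued fact is introduced; standard axioms.
-/

namespace Literature.MathematicalPhysics.QuantumFieldTheory.BalabanImbrieJaffe1984to88.BIJ88RT51Density

open Literature.MathematicalPhysics.QuantumFieldTheory.Balaban1983to89
open BIJ88Sect3Statements (U1)
open BIJ85Sect1Model (HiggsField)
open BIJ88RenormTransf311 (gaussWeight)
open BIJ88RT311Exists (gaussApprox)
open BIJ88InductiveForm41 (Prev prevMeasure)
open scoped BigOperators ENNReal
open _root_.MeasureTheory _root_.MeasureTheory.Measure Complex Function

noncomputable section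

variable {P : Params} {k : ℕ}

/-! ## §1 The engine: the Radon–Nikodym density of a complex weight pushed forward along `(u, ψ) ↦ (Qu, ψ)` -/

section Engine

variable {ν : Measure (GaugeField P k U1)} {Qu : GaugeField P k U1 → GaugeField P (k+1) U1}

/-- The CONSTRAINT MAP of `δ(v/Qu)` in (5.1.1), jointly with the untouched block scalar field: `(u, ψ) ↦ (Qu, ψ)` (the push-forward reading of
the `δ`-function, [2] (3.5)). [cite: BalabanImbrieJaffe1988, (5.1.1) p.277] -/
def conMap (Qu : GaugeField P k U1 → GaugeField P (k+1) U1) :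
    GaugeField P k U1 × HiggsField P (k+1) → GaugeField P (k+1) U1 × HiggsField P (k+1) :=
  Prod.map Qu id

/-- kernel: the value of the constraint map. [cite: BalabanImbrieJaffe1988, (5.1.1) p.277] -/
@[simp] theorem conMap_apply (Qu : GaugeField P k U1 → GaugeField P (k+1) U1) (p : GaugeField P k U1 × HiggsField P (k+1)) :
    conMap Qu p = (Qu p.1, p.2) := rfl

/-- kernel: the constraint map is measurable for measurable `Qu`. [cite: BalabanImbrieJaffe1988, (5.1.1) p.277] -/
theorem measurable_conMap (hQu : Measurable Qu) : Measurable (conMap (P := P) (k := k) Qu) := hQu.prodMap measurable_id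

/-- The PUSHED-FORWARD LAW on the block fields of a real weight `h(u, ψ)` (negative values cut off): the image under the constraint map of
`h⁺ · (ν ⊗ dψ)`, `ν` the `u`-measure (`𝒟u` or `𝒟u δ_{Ax}(u)`). [cite: BalabanImbrieJaffe1988, (5.1.1) p.277] -/
def pushLaw (ν : Measure (GaugeField P k U1)) (Qu : GaugeField P k U1 → GaugeField P (k+1) U1)
    (h : GaugeField P k U1 × HiggsField P (k+1) → ℝ) : Measure (GaugeField P (k+1) U1 × HiggsField P (k+1)) :=
  ((ν.prod volume).withDensity fun p => ENNReal.ofReal (h p)).map (conMap Qu)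

/-- kernel: the pushed-forward law of a `ν ⊗ dψ`-integrable weight is a finite measure. [cite: BalabanImbrieJaffe1988, (5.1.1) p.277] -/
theorem isFiniteMeasure_pushLaw {h : GaugeField P k U1 × HiggsField P (k+1) → ℝ} (hh : Integrable h (ν.prod volume)) :
    IsFiniteMeasure (pushLaw ν Qu h) := by
  haveI := isFiniteMeasure_withDensity_ofReal hh.2
  unfold pushLaw
  infer_instance

/-- kernel: **the pushed-forward law is absolutely continuous w.r.t. `dv dψ`** — this is where the Haar regularity `ν.map Qu ≪ dv` of the
gauge-field block average enters (for the printed (2.10): r18's `BIJ85BlockAveragesTorus.map_qU_fieldMeasure`, file 2/2).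
[cite: BalabanImbrieJaffe1988, (5.1.1) p.277] -/
theorem pushLaw_absolutelyContinuous [SFinite ν] (hQu : Measurable Qu) (hac : ν.map Qu ≪ fieldMeasure P (k+1) U1)
    (h : GaugeField P k U1 × HiggsField P (k+1) → ℝ) :
    pushLaw ν Qu h ≪ (fieldMeasure P (k+1) U1).prod volume := by
  have h1 : pushLaw ν Qu h ≪ (ν.prod volume).map (conMap Qu) :=
    (withDensity_absolutelyContinuous _ _).map (measurable_conMap hQu)
  have h2 : (ν.prod (volume : Measure (HiggsField P (k+1)))).map (conMap Qu) = (ν.map Qu).prod volume := by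
    unfold conMap
    rw [← Measure.map_prod_map _ _ hQu measurable_id, Measure.map_id]
  rw [h2] at h1
  exact h1.trans (Measure.AbsolutelyContinuous.prod hac (Measure.AbsolutelyContinuous.refl _))

/-- kernel: integrating a measurable test function against the pushed-forward law: `∫ g d(pushLaw h) = ∫ν(du)∫dψ h⁺(u, ψ) g(Qu, ψ)`.
[cite: BalabanImbrieJaffe1988, (5.1.1) p.277] -/
theorem integral_pushLaw [SFinite ν] (hQu : Measurable Qu) {h : GaugeField P k U1 × HiggsField P (k+1) → ℝ}
    (hh : Integrable h (ν.prod volume)) {g : GaugeField P (k+1) U1 × HiggsField P (k+1) → ℂ} (hg : Measurable g) :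
    ∫ z, g z ∂pushLaw ν Qu h = ∫ p, (max (h p) 0) • g (Qu p.1, p.2) ∂ν.prod volume := by
  unfold pushLaw
  rw [integral_map (measurable_conMap hQu).aemeasurable hg.aestronglyMeasurable,
    integral_withDensity_eq_integral_toReal_smul₀ hh.1.aemeasurable.ennreal_ofReal
      (Filter.Eventually.of_forall fun _ => ENNReal.ofReal_lt_top)]
  simp only [ENNReal.toReal_ofReal', conMap_apply]

/-- The Radon–Nikodym density w.r.t. `dv dψ` of the pushed-forward law of a REAL weight (difference of the positive and negative parts).
[cite: BalabanImbrieJaffe1988, (5.1.1) p.277] -/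
def rnRe (ν : Measure (GaugeField P k U1)) (Qu : GaugeField P k U1 → GaugeField P (k+1) U1)
    (h : GaugeField P k U1 × HiggsField P (k+1) → ℝ) (q : GaugeField P (k+1) U1 × HiggsField P (k+1)) : ℝ :=
  ((pushLaw ν Qu h).rnDeriv ((fieldMeasure P (k+1) U1).prod volume) q).toReal
    - ((pushLaw ν Qu fun p => -h p).rnDeriv ((fieldMeasure P (k+1) U1).prod volume) q).toReal

/-- kernel: the real Radon–Nikodym density is measurable. [cite: BalabanImbrieJaffe1988, (5.1.1) p.277] -/
theorem measurable_rnRe (h : GaugeField P k U1 × HiggsField P (k+1) → ℝ) : Measurable (rnRe ν Qu h) :=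
  (Measure.measurable_rnDeriv _ _).ennreal_toReal.sub (Measure.measurable_rnDeriv _ _).ennreal_toReal

/-- kernel: the real Radon–Nikodym density of an integrable weight is `dv dψ`-integrable. [cite: BalabanImbrieJaffe1988, (5.1.1) p.277] -/
theorem integrable_rnRe {h : GaugeField P k U1 × HiggsField P (k+1) → ℝ} (hh : Integrable h (ν.prod volume)) :
    Integrable (rnRe ν Qu h) ((fieldMeasure P (k+1) U1).prod volume) := by
  have hhn : Integrable (fun p => -h p) (ν.prod volume) := hh.neg
  haveI := isFiniteMeasure_pushLaw (Qu := Qu) hh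
  haveI := isFiniteMeasure_pushLaw (Qu := Qu) hhn
  exact Measure.integrable_toReal_rnDeriv.sub Measure.integrable_toReal_rnDeriv

/-- kernel: **the real Radon–Nikodym density integrates test functions back to the fine lattice** — for a real `ν ⊗ dψ`-integrable weight `h`
and a bounded measurable `g(v, ψ)`, `∫dv dψ rnRe(h)·g = ∫ν(du)∫dψ h(u, ψ) g(Qu, ψ)` (`Measure.integral_rnDeriv_smul` for the two parts; absolute
continuity from the Haar regularity of `Qu`). [cite: BalabanImbrieJaffe1988, (5.1.1) p.277] -/
theorem integral_rnRe_smul [SFinite ν] (hQu : Measurable Qu) (hac : ν.map Qu ≪ fieldMeasure P (k+1) U1)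
    {h : GaugeField P k U1 × HiggsField P (k+1) → ℝ} (hh : Integrable h (ν.prod volume))
    {g : GaugeField P (k+1) U1 × HiggsField P (k+1) → ℂ} (hg : Measurable g) {C : ℝ} (hC : ∀ z, ‖g z‖ ≤ C) :
    ∫ q, (rnRe ν Qu h q) • g q ∂(fieldMeasure P (k+1) U1).prod volume = ∫ p, (h p) • g (Qu p.1, p.2) ∂ν.prod volume := by
  have hhn : Integrable (fun p => -h p) (ν.prod volume) := hh.neg
  haveI := isFiniteMeasure_pushLaw (Qu := Qu) hh
  haveI := isFiniteMeasure_pushLaw (Qu := Qu) hhn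
  have hgb : AEStronglyMeasurable (fun p : GaugeField P k U1 × HiggsField P (k+1) => g (Qu p.1, p.2)) (ν.prod volume) :=
    (hg.comp ((hQu.comp measurable_fst).prodMk measurable_snd)).aestronglyMeasurable
  have I1 : Integrable (fun q => ((pushLaw ν Qu h).rnDeriv ((fieldMeasure P (k+1) U1).prod volume) q).toReal • g q)
      ((fieldMeasure P (k+1) U1).prod volume) :=
    Measure.integrable_toReal_rnDeriv.smul_bdd C hg.aestronglyMeasurable (Filter.Eventually.of_forall hC)
  have I2 : Integrable (fun q => ((pushLaw ν Qu fun p => -h p).rnDeriv ((fieldMeasure P (k+1) U1).prod volume) q).toReal • g q)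
      ((fieldMeasure P (k+1) U1).prod volume) :=
    Measure.integrable_toReal_rnDeriv.smul_bdd C hg.aestronglyMeasurable (Filter.Eventually.of_forall hC)
  have I3 : Integrable (fun p : GaugeField P k U1 × HiggsField P (k+1) => (max (h p) 0) • g (Qu p.1, p.2)) (ν.prod volume) :=
    hh.pos_part.smul_bdd C hgb (Filter.Eventually.of_forall fun p => hC _)
  have I4 : Integrable (fun p : GaugeField P k U1 × HiggsField P (k+1) => (max (-h p) 0) • g (Qu p.1, p.2)) (ν.prod volume) :=
    hhn.pos_part.smul_bdd C hgb (Filter.Eventually.of_forall fun p => hC _)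
  have e : ∀ q, (rnRe ν Qu h q) • g q = ((pushLaw ν Qu h).rnDeriv ((fieldMeasure P (k+1) U1).prod volume) q).toReal • g q
      - ((pushLaw ν Qu fun p => -h p).rnDeriv ((fieldMeasure P (k+1) U1).prod volume) q).toReal • g q := fun q => by
    rw [rnRe, sub_smul]
  simp_rw [e]
  rw [integral_sub I1 I2, integral_rnDeriv_smul (pushLaw_absolutelyContinuous hQu hac h),
    integral_rnDeriv_smul (pushLaw_absolutelyContinuous hQu hac fun p => -h p), integral_pushLaw hQu hh hg,
    integral_pushLaw hQu hhn hg, ← integral_sub I3 I4]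
  refine integral_congr_ae (Filter.Eventually.of_forall fun p => ?_)
  simp only [← sub_smul, max_zero_sub_max_neg_zero_eq_self]

/-- **The COMPLEX Radon–Nikodym density `rnC ν Qu G (v, ψ)`** of the push-forward along `(u, ψ) ↦ (Qu, ψ)` of `G(u, ψ) · (ν ⊗ dψ)` w.r.t.
`dv dψ` (real and imaginary parts through `rnRe`) — the measure-level reading of `∫ν(du) δ(v/Qu) G(u, ψ)` in (5.1.1) (as gen 2's `BIJ85RT33.RTData.rt`
reads [2] (3.3), there for the `φ`-smeared weight of one history-free term in the axial gauge). [cite: BalabanImbrieJaffe1988, (5.1.1) p.277] -/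
def rnC (ν : Measure (GaugeField P k U1)) (Qu : GaugeField P k U1 → GaugeField P (k+1) U1)
    (G : GaugeField P k U1 × HiggsField P (k+1) → ℂ) (V : GaugeField P (k+1) U1) (ψ : HiggsField P (k+1)) : ℂ :=
  (rnRe ν Qu (fun p => (G p).re) (V, ψ) : ℂ) + (rnRe ν Qu (fun p => (G p).im) (V, ψ) : ℂ) * I

/-- kernel: unfolding `rnC` on the product. [cite: BalabanImbrieJaffe1988, (5.1.1) p.277] -/
theorem uncurry_rnC (G : GaugeField P k U1 × HiggsField P (k+1) → ℂ) :
    uncurry (rnC ν Qu G) = fun q => (rnRe ν Qu (fun p => (G p).re) q : ℂ) + (rnRe ν Qu (fun p => (G p).im) q : ℂ) * I := by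
  funext q
  rfl

/-- kernel: the complex Radon–Nikodym density is jointly measurable in `(v, ψ)`. [cite: BalabanImbrieJaffe1988, (5.1.1) p.277] -/
theorem measurable_rnC (G : GaugeField P k U1 × HiggsField P (k+1) → ℂ) : Measurable (uncurry (rnC ν Qu G)) := by
  rw [uncurry_rnC]
  exact (Complex.measurable_ofReal.comp (measurable_rnRe _)).add
    ((Complex.measurable_ofReal.comp (measurable_rnRe _)).mul_const I)

/-- kernel: **the complex Radon–Nikodym density of a `ν ⊗ dψ`-integrable weight is `dv dψ`-integrable.** [cite: BalabanImbrieJaffe1988, (5.1.1) p.277] -/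
theorem integrable_rnC {G : GaugeField P k U1 × HiggsField P (k+1) → ℂ} (hG : Integrable G (ν.prod volume)) :
    Integrable (uncurry (rnC ν Qu G)) ((fieldMeasure P (k+1) U1).prod volume) := by
  rw [uncurry_rnC]
  exact (integrable_rnRe hG.re).ofReal.add ((integrable_rnRe hG.im).ofReal.mul_const I)

/-- **`∫dv dψ (rnC G)(v, ψ) g(v, ψ) = ∫ν(du)∫dψ G(u, ψ) g(Qu, ψ)`** for a `ν ⊗ dψ`-integrable complex weight `G` and every bounded measurable test
function `g` (measurable Haar-regular `Qu`): the complex Radon–Nikodym density integrates test functions back to the fine lattice — `δ(v/Qu)` as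
a push-forward. [cite: BalabanImbrieJaffe1988, (5.1.1) p.277] -/
theorem integral_rnC_mul [SFinite ν] (hQu : Measurable Qu) (hac : ν.map Qu ≪ fieldMeasure P (k+1) U1)
    {G : GaugeField P k U1 × HiggsField P (k+1) → ℂ} (hG : Integrable G (ν.prod volume))
    {g : GaugeField P (k+1) U1 × HiggsField P (k+1) → ℂ} (hg : Measurable g) {C : ℝ} (hC : ∀ z, ‖g z‖ ≤ C) :
    ∫ q, uncurry (rnC ν Qu G) q * g q ∂(fieldMeasure P (k+1) U1).prod volume =
      ∫ p, G p * g (Qu p.1, p.2) ∂ν.prod volume := by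
  have hgI : Measurable fun z => I * g z := hg.const_mul I
  have hCI : ∀ z, ‖I * g z‖ ≤ C := fun z => by rw [norm_mul, Complex.norm_I, one_mul]; exact hC z
  have hQp : Measurable fun p : GaugeField P k U1 × HiggsField P (k+1) => (Qu p.1, p.2) :=
    (hQu.comp measurable_fst).prodMk measurable_snd
  have hgb : AEStronglyMeasurable (fun p : GaugeField P k U1 × HiggsField P (k+1) => g (Qu p.1, p.2)) (ν.prod volume) :=
    (hg.comp hQp).aestronglyMeasurable
  have hgbI : AEStronglyMeasurable (fun p : GaugeField P k U1 × HiggsField P (k+1) => I * g (Qu p.1, p.2)) (ν.prod volume) :=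
    (hgI.comp hQp).aestronglyMeasurable
  have hre : Integrable (fun p => (G p).re) (ν.prod volume) := hG.re
  have him : Integrable (fun p => (G p).im) (ν.prod volume) := hG.im
  have J1 : Integrable (fun q => (rnRe ν Qu (fun p => (G p).re) q) • g q) ((fieldMeasure P (k+1) U1).prod volume) :=
    (integrable_rnRe hre).smul_bdd C hg.aestronglyMeasurable (Filter.Eventually.of_forall hC)
  have J2 : Integrable (fun q => (rnRe ν Qu (fun p => (G p).im) q) • (I * g q)) ((fieldMeasure P (k+1) U1).prod volume) :=
    (integrable_rnRe him).smul_bdd C hgI.aestronglyMeasurable (Filter.Eventually.of_forall hCI)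
  have J3 : Integrable (fun p : GaugeField P k U1 × HiggsField P (k+1) => (G p).re • g (Qu p.1, p.2)) (ν.prod volume) :=
    hre.smul_bdd C hgb (Filter.Eventually.of_forall fun p => hC _)
  have J4 : Integrable (fun p : GaugeField P k U1 × HiggsField P (k+1) => (G p).im • (I * g (Qu p.1, p.2))) (ν.prod volume) :=
    him.smul_bdd C hgbI (Filter.Eventually.of_forall fun p => hCI _)
  have eL : ∀ q, uncurry (rnC ν Qu G) q * g q = (rnRe ν Qu (fun p => (G p).re) q) • g q
      + (rnRe ν Qu (fun p => (G p).im) q) • (I * g q) := by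
    rintro ⟨V, ψ⟩
    simp only [uncurry_apply_pair, rnC, Complex.real_smul]
    ring
  have eR : ∀ p : GaugeField P k U1 × HiggsField P (k+1), G p * g (Qu p.1, p.2) = (G p).re • g (Qu p.1, p.2)
      + (G p).im • (I * g (Qu p.1, p.2)) := fun p => by
    simp only [Complex.real_smul]
    conv_lhs => rw [← Complex.re_add_im (G p)]
    ring
  simp_rw [eL, eR]
  rw [integral_add J1 J2, integral_add J3 J4, integral_rnRe_smul hQu hac hre hg hC, integral_rnRe_smul hQu hac him hgI hCI]

end Engine

/-! ## §2 The `({u^{(j)}}, φ)`-smeared density of one term of (5.1.1) -/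

section Smear

variable {ν : Measure (GaugeField P k U1)}
variable {Qφ : Prev P k → GaugeField P k U1 → HiggsField P k → HiggsField P (k+1)} {a : ℝ}
variable {ρ' : Prev P k → GaugeField P k U1 → HiggsField P k → ℂ}

/-- kernel (plumbing): r18's block-field Gaussian weight `gaussWeight a c ψ` of (3.11)/(5.1.1) is measurable along any measurable
parametrizations of its centre `c` and of `ψ` — proved structurally (`exp` of a finite sum of squared norms of coordinates), which keeps the
elaborator away from unfolding the weight against `Function.uncurry` on products of pi types (gen 5's lesson).
[cite: BalabanImbrieJaffe1988, (5.1.1) p.277] -/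
theorem measurable_gaussWeight_param {α : Type*} [MeasurableSpace α] (a : ℝ) {c ψ : α → HiggsField P (k+1)}
    (hc : Measurable c) (hψ : Measurable ψ) : Measurable fun x => gaussWeight (P := P) (j := k) a (c x) (ψ x) := by
  unfold gaussWeight
  refine Real.measurable_exp.comp (Measurable.sub_const (Measurable.const_mul (Finset.measurable_sum _ fun y _ => ?_) _) _)
  exact ((((measurable_pi_apply y).comp hψ).sub ((measurable_pi_apply y).comp hc)).norm.pow_const 2).const_mul _

/-- THE SMEARED TERM DENSITY of (5.1.1): `G_t(u, ψ) = ∫Π𝒟u^{(j)} ∫𝒟φ ρ′_t({u^{(j)}}, u, φ) · exp[−½aL⁻²⟨ψ − Q_tφ, ψ − Q_tφ⟩ − |T_L|E^{(k)}]`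
— the `Π𝒟u^{(j)}`- and `𝒟φ`-integrals of one term at fixed `u` and `ψ` (`Q_t = Q(u_k)φ` the background scalar average of the term, as data).
[cite: BalabanImbrieJaffe1988, (5.1.1) p.277] -/
def smear51 (Qφ : Prev P k → GaugeField P k U1 → HiggsField P k → HiggsField P (k+1)) (a : ℝ)
    (ρ' : Prev P k → GaugeField P k U1 → HiggsField P k → ℂ) (p : GaugeField P k U1 × HiggsField P (k+1)) : ℂ :=
  ∫ prev, ∫ φ, ρ' prev p.1 φ * (gaussWeight a (Qφ prev p.1 φ) p.2 : ℂ) ∂volume ∂prevMeasure P k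

/-- kernel (plumbing): the full integrand `(((u, ψ), {u^{(j)}}), φ) ↦ ρ′({u^{(j)}}, u, φ) · gaussWeight_a(Q({u^{(j)}}, u, φ), ψ)` of the smeared
density is jointly measurable when `ρ′` and the background kernel are. [cite: BalabanImbrieJaffe1988, (5.1.1) p.277] -/
theorem measurable_smearIntegrand
    (hQφ : Measurable fun p : Prev P k × (GaugeField P k U1 × HiggsField P k) => Qφ p.1 p.2.1 p.2.2)
    (hρ : Measurable fun p : Prev P k × (GaugeField P k U1 × HiggsField P k) => ρ' p.1 p.2.1 p.2.2) :
    Measurable fun q : ((GaugeField P k U1 × HiggsField P (k+1)) × Prev P k) × HiggsField P k =>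
      ρ' q.1.2 q.1.1.1 q.2 * (gaussWeight a (Qφ q.1.2 q.1.1.1 q.2) q.1.1.2 : ℂ) := by
  have hsh : Measurable fun q : ((GaugeField P k U1 × HiggsField P (k+1)) × Prev P k) × HiggsField P k =>
      (q.1.2, (q.1.1.1, q.2)) :=
    (measurable_snd.comp measurable_fst).prodMk
      ((measurable_fst.comp (measurable_fst.comp measurable_fst)).prodMk measurable_snd)
  have h1 : Measurable fun q : ((GaugeField P k U1 × HiggsField P (k+1)) × Prev P k) × HiggsField P k =>
      ρ' q.1.2 q.1.1.1 q.2 := hρ.comp hsh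
  have h2 : Measurable fun q : ((GaugeField P k U1 × HiggsField P (k+1)) × Prev P k) × HiggsField P k =>
      (gaussWeight a (Qφ q.1.2 q.1.1.1 q.2) q.1.1.2 : ℂ) :=
    Complex.measurable_ofReal.comp
      (measurable_gaussWeight_param a (hQφ.comp hsh) (measurable_snd.comp (measurable_fst.comp measurable_fst)))
  exact h1.mul h2

/-- **The smeared term density is jointly measurable in `(u, ψ)`** (Fubini measurability for the `𝒟φ`- and `Π𝒟u^{(j)}`-integrals).
[cite: BalabanImbrieJaffe1988, (5.1.1) p.277] -/
theorem measurable_smear51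
    (hQφ : Measurable fun p : Prev P k × (GaugeField P k U1 × HiggsField P k) => Qφ p.1 p.2.1 p.2.2)
    (hρ : Measurable fun p : Prev P k × (GaugeField P k U1 × HiggsField P k) => ρ' p.1 p.2.1 p.2.2) :
    Measurable (smear51 Qφ a ρ') := by
  have h2 : StronglyMeasurable fun x : (GaugeField P k U1 × HiggsField P (k+1)) × Prev P k =>
      ∫ φ, ρ' x.2 x.1.1 φ * (gaussWeight a (Qφ x.2 x.1.1 φ) x.1.2 : ℂ) :=
    (measurable_smearIntegrand hQφ hρ).stronglyMeasurable.integral_prod_right' (ν := volume)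
  exact (h2.integral_prod_right' (ν := prevMeasure P k)).measurable

/-- kernel: **`∫⁻dψ ‖G(u, ψ)‖ ≤ ∫⁻Π𝒟u^{(j)}𝒟φ ‖ρ′({u^{(j)}}, u, φ)‖` at every `u`** — Tonelli, and the unit `dψ`-mass of the Gaussian ((3.12) /
(5.1.2), `a > 0`, `d ≥ 2`: gen 2's `BIJ85RT37Normalization.lintegral_norm_mul_K` for `gaussApprox`). [cite: BalabanImbrieJaffe1988, (5.1.2) p.277] -/
theorem lintegral_norm_smear51_le (ha : 0 < a) (hd : 2 ≤ P.d)
    (hQφ : Measurable fun p : Prev P k × (GaugeField P k U1 × HiggsField P k) => Qφ p.1 p.2.1 p.2.2)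
    (hρ : Measurable fun p : Prev P k × (GaugeField P k U1 × HiggsField P k) => ρ' p.1 p.2.1 p.2.2) (U : GaugeField P k U1) :
    ∫⁻ ψ, ‖smear51 Qφ a ρ' (U, ψ)‖ₑ ≤ ∫⁻ p : Prev P k × HiggsField P k, ‖ρ' p.1 U p.2‖ₑ ∂(prevMeasure P k).prod volume := by
  -- the integrand at fixed `u`, on `((ψ, {u^{(j)}}), φ)`-space
  have hshU : Measurable fun q : (HiggsField P (k+1) × Prev P k) × HiggsField P k => (q.1.2, (U, q.2)) :=
    (measurable_snd.comp measurable_fst).prodMk (measurable_const.prodMk measurable_snd)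
  have hF : Measurable fun q : (HiggsField P (k+1) × Prev P k) × HiggsField P k =>
      ρ' q.1.2 U q.2 * (gaussWeight a (Qφ q.1.2 U q.2) q.1.1 : ℂ) :=
    (hρ.comp hshU).mul (Complex.measurable_ofReal.comp
      (measurable_gaussWeight_param a (hQφ.comp hshU) (measurable_fst.comp measurable_fst)))
  -- the same at fixed `u` and `{u^{(j)}}`, on `(ψ, φ)`-space
  have hF2 : ∀ prev : Prev P k, Measurable fun q : HiggsField P (k+1) × HiggsField P k =>
      ‖ρ' prev U q.2 * (gaussWeight a (Qφ prev U q.2) q.1 : ℂ)‖ₑ := fun prev =>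
    (hF.comp ((measurable_fst.prodMk measurable_const).prodMk measurable_snd)).enorm
  have hsec : Measurable fun p : Prev P k × HiggsField P k => ‖ρ' p.1 U p.2‖ₑ :=
    (hρ.comp (measurable_fst.prodMk (measurable_const.prodMk measurable_snd))).enorm
  calc ∫⁻ ψ, ‖smear51 Qφ a ρ' (U, ψ)‖ₑ
      ≤ ∫⁻ ψ, ∫⁻ prev, ∫⁻ φ, ‖ρ' prev U φ * (gaussWeight a (Qφ prev U φ) ψ : ℂ)‖ₑ ∂volume ∂prevMeasure P k :=
        lintegral_mono fun ψ => (enorm_integral_le_lintegral_enorm _).trans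
          (lintegral_mono fun prev => enorm_integral_le_lintegral_enorm _)
    _ = ∫⁻ prev, ∫⁻ ψ, ∫⁻ φ, ‖ρ' prev U φ * (gaussWeight a (Qφ prev U φ) ψ : ℂ)‖ₑ ∂volume ∂volume ∂prevMeasure P k :=
        lintegral_lintegral_swap (hF.enorm.lintegral_prod_right').aemeasurable
    _ = ∫⁻ prev, ∫⁻ φ, ∫⁻ ψ, ‖ρ' prev U φ * (gaussWeight a (Qφ prev U φ) ψ : ℂ)‖ₑ ∂volume ∂volume ∂prevMeasure P k :=
        lintegral_congr fun prev => lintegral_lintegral_swap (hF2 prev).aemeasurable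
    _ = ∫⁻ prev, ∫⁻ φ, ‖ρ' prev U φ‖ₑ ∂volume ∂prevMeasure P k :=
        lintegral_congr fun prev => lintegral_congr fun φ =>
          BIJ85RT37Normalization.lintegral_norm_mul_K (A := gaussApprox (P := P) (j := k) ha hd) (ρ' prev U φ) (Qφ prev U φ)
    _ = ∫⁻ p : Prev P k × HiggsField P k, ‖ρ' p.1 U p.2‖ₑ ∂(prevMeasure P k).prod volume :=
        (lintegral_prod _ hsec.aemeasurable).symm

/-- **The smeared term density is `ν ⊗ dψ`-integrable** for every s-finite `u`-measure `ν` (`𝒟u`, `𝒟u δ_{Ax}`) as soon as the term density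
`ρ′` is `ν ⊗ Π𝒟u^{(j)} ⊗ 𝒟φ`-integrable (`a > 0`, `d ≥ 2`). [cite: BalabanImbrieJaffe1988, (5.1.1) p.277] -/
theorem integrable_smear51 [SFinite ν] (ha : 0 < a) (hd : 2 ≤ P.d)
    (hQφ : Measurable fun p : Prev P k × (GaugeField P k U1 × HiggsField P k) => Qφ p.1 p.2.1 p.2.2)
    (hρ : Measurable fun p : Prev P k × (GaugeField P k U1 × HiggsField P k) => ρ' p.1 p.2.1 p.2.2)
    (hρi : Integrable (fun q : GaugeField P k U1 × (Prev P k × HiggsField P k) => ρ' q.2.1 q.1 q.2.2)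
      (ν.prod ((prevMeasure P k).prod volume))) :
    Integrable (smear51 Qφ a ρ') (ν.prod volume) := by
  refine ⟨(measurable_smear51 hQφ hρ).aestronglyMeasurable, ?_⟩
  have hmeas : Measurable fun q : GaugeField P k U1 × (Prev P k × HiggsField P k) => ρ' q.2.1 q.1 q.2.2 :=
    hρ.comp ((measurable_fst.comp measurable_snd).prodMk (measurable_fst.prodMk (measurable_snd.comp measurable_snd)))
  have hfin := hρi.2
  unfold HasFiniteIntegral at hfin ⊢
  rw [lintegral_prod _ hmeas.enorm.aemeasurable] at hfin
  rw [lintegral_prod _ (measurable_smear51 hQφ hρ).enorm.aemeasurable]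
  exact lt_of_le_of_lt (lintegral_mono fun U => lintegral_norm_smear51_le ha hd hQφ hρ U) hfin

/-- kernel: at a `u` at which `({u^{(j)}}, φ) ↦ ρ′({u^{(j)}}, u, φ)` is `Π𝒟u^{(j)} ⊗ 𝒟φ`-integrable, the integrand `(({u^{(j)}}, φ), ψ) ↦
ρ′ · gaussWeight_a(Q, ψ) · g(ψ)` is integrable on the triple product for bounded measurable `g` (Tonelli, unit mass of the Gaussian).
[cite: BalabanImbrieJaffe1988, (5.1.1) p.277] -/
theorem integrable_smearIntegrand_mul (ha : 0 < a) (hd : 2 ≤ P.d)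
    (hQφ : Measurable fun p : Prev P k × (GaugeField P k U1 × HiggsField P k) => Qφ p.1 p.2.1 p.2.2)
    (hρ : Measurable fun p : Prev P k × (GaugeField P k U1 × HiggsField P k) => ρ' p.1 p.2.1 p.2.2) (U : GaugeField P k U1)
    (hU : Integrable (fun p : Prev P k × HiggsField P k => ρ' p.1 U p.2) ((prevMeasure P k).prod volume))
    {g : HiggsField P (k+1) → ℂ} (hg : Measurable g) {C : ℝ} (hC : ∀ ψ, ‖g ψ‖ ≤ C) :
    Integrable (fun q : (Prev P k × HiggsField P k) × HiggsField P (k+1) =>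
      ρ' q.1.1 U q.1.2 * (gaussWeight a (Qφ q.1.1 U q.1.2) q.2 : ℂ) * g q.2) (((prevMeasure P k).prod volume).prod volume) := by
  have hshU : Measurable fun q : (Prev P k × HiggsField P k) × HiggsField P (k+1) => (q.1.1, (U, q.1.2)) :=
    (measurable_fst.comp measurable_fst).prodMk (measurable_const.prodMk (measurable_snd.comp measurable_fst))
  have hF : Measurable fun q : (Prev P k × HiggsField P k) × HiggsField P (k+1) =>
      ρ' q.1.1 U q.1.2 * (gaussWeight a (Qφ q.1.1 U q.1.2) q.2 : ℂ) :=
    (hρ.comp hshU).mul (Complex.measurable_ofReal.comp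
      (measurable_gaussWeight_param a (hQφ.comp hshU) measurable_snd))
  have I0 : Integrable (fun q : (Prev P k × HiggsField P k) × HiggsField P (k+1) =>
      ρ' q.1.1 U q.1.2 * (gaussWeight a (Qφ q.1.1 U q.1.2) q.2 : ℂ)) (((prevMeasure P k).prod volume).prod volume) := by
    refine ⟨hF.aestronglyMeasurable, ?_⟩
    have hfin := hU.2
    unfold HasFiniteIntegral at hfin ⊢
    rw [lintegral_prod _ hF.enorm.aemeasurable]
    calc ∫⁻ p, ∫⁻ ψ, ‖ρ' p.1 U p.2 * (gaussWeight a (Qφ p.1 U p.2) ψ : ℂ)‖ₑ ∂volume ∂(prevMeasure P k).prod volume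
        = ∫⁻ p, ‖ρ' p.1 U p.2‖ₑ ∂(prevMeasure P k).prod volume :=
          lintegral_congr fun p =>
            BIJ85RT37Normalization.lintegral_norm_mul_K (A := gaussApprox (P := P) (j := k) ha hd) (ρ' p.1 U p.2) (Qφ p.1 U p.2)
      _ < ⊤ := hfin
  exact I0.mul_bdd ((hg.comp measurable_snd).aestronglyMeasurable) (Filter.Eventually.of_forall fun q => hC q.2)

/-- **Fubini at fixed `u`**: `∫dψ G(u, ψ) g(ψ) = ∫Π𝒟u^{(j)} ∫𝒟φ ∫dψ ρ′({u^{(j)}}, u, φ) gaussWeight_a(Q, ψ) g(ψ)` for bounded measurable `g`, at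
every `u` at which `ρ′(·, u, ·)` is `Π𝒟u^{(j)} ⊗ 𝒟φ`-integrable — the order of (5.1.1) (test function innermost) recovered from the smeared
density. [cite: BalabanImbrieJaffe1988, (5.1.1) p.277] -/
theorem integral_smear51_mul (ha : 0 < a) (hd : 2 ≤ P.d)
    (hQφ : Measurable fun p : Prev P k × (GaugeField P k U1 × HiggsField P k) => Qφ p.1 p.2.1 p.2.2)
    (hρ : Measurable fun p : Prev P k × (GaugeField P k U1 × HiggsField P k) => ρ' p.1 p.2.1 p.2.2) (U : GaugeField P k U1)
    (hU : Integrable (fun p : Prev P k × HiggsField P k => ρ' p.1 U p.2) ((prevMeasure P k).prod volume))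
    {g : HiggsField P (k+1) → ℂ} (hg : Measurable g) {C : ℝ} (hC : ∀ ψ, ‖g ψ‖ ≤ C) :
    ∫ ψ, smear51 Qφ a ρ' (U, ψ) * g ψ =
      ∫ prev, ∫ φ, ∫ ψ, ρ' prev U φ * (gaussWeight a (Qφ prev U φ) ψ : ℂ) * g ψ ∂volume ∂volume ∂prevMeasure P k := by
  have hint := integrable_smearIntegrand_mul ha hd hQφ hρ U hU hg hC
  -- (1) the test function enters the `({u^{(j)}}, φ)`-integrals
  have e1 : ∀ ψ, smear51 Qφ a ρ' (U, ψ) * g ψ =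
      ∫ prev, ∫ φ, ρ' prev U φ * (gaussWeight a (Qφ prev U φ) ψ : ℂ) * g ψ ∂volume ∂prevMeasure P k := fun ψ => by
    unfold smear51
    simp_rw [← integral_mul_const]
  simp_rw [e1]
  -- (2) a.e. in `ψ`, the iterated `({u^{(j)}}, φ)`-integral is the integral over the product
  have e2 : (fun ψ => ∫ prev, ∫ φ, ρ' prev U φ * (gaussWeight a (Qφ prev U φ) ψ : ℂ) * g ψ ∂volume ∂prevMeasure P k)
      =ᵐ[volume] fun ψ => ∫ p : Prev P k × HiggsField P k, ρ' p.1 U p.2 * (gaussWeight a (Qφ p.1 U p.2) ψ : ℂ) * g ψ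
        ∂(prevMeasure P k).prod volume := by
    filter_upwards [hint.prod_left_ae] with ψ hψ
    exact (integral_prod _ hψ).symm
  rw [integral_congr_ae e2]
  -- (3) swap `ψ` with the pair `({u^{(j)}}, φ)`, then split the pair
  have hint' : Integrable (uncurry fun (ψ : HiggsField P (k+1)) (p : Prev P k × HiggsField P k) =>
      ρ' p.1 U p.2 * (gaussWeight a (Qφ p.1 U p.2) ψ : ℂ) * g ψ)
      ((volume : Measure (HiggsField P (k+1))).prod ((prevMeasure P k).prod volume)) := hint.swap
  calc ∫ ψ, ∫ p : Prev P k × HiggsField P k, ρ' p.1 U p.2 * (gaussWeight a (Qφ p.1 U p.2) ψ : ℂ) * g ψ ∂(prevMeasure P k).prod volume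
      = ∫ p : Prev P k × HiggsField P k, ∫ ψ, ρ' p.1 U p.2 * (gaussWeight a (Qφ p.1 U p.2) ψ : ℂ) * g ψ ∂volume
          ∂(prevMeasure P k).prod volume := integral_integral_swap hint'
    _ = ∫ prev, ∫ φ, ∫ ψ, ρ' prev U φ * (gaussWeight a (Qφ prev U φ) ψ : ℂ) * g ψ ∂volume ∂volume ∂prevMeasure P k :=
          integral_prod _ hint.integral_prod_left

end Smear

end

end Literature.MathematicalPhysics.QuantumFieldTheory.BalabanImbrieJaffe1984to88.BIJ88RT51Density
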